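import Summits.AtomisticToContinuum.Crystallization.Theorems.LayeredLawsSelectHcp.Negative.IntendedModel

/-!
# Negative knowledge for crux `LayeredLawsSelectHcp` (stmt-AtomisticToContinuum-9226), XVIII-A:
# the window lemma for relaxed hcp and the vertical stretch `tubeMap`

Part XVIII-A (`--supports stmt-AtomisticToContinuum-9226`; gen 2 / cycle 2 of the standing disprover). Part XIII's
consistency theorem `crux_consistent` is conditional on IDEAL hcp (`h = a√⅔`) minimising; but the relaxed
Lennard-Jones hcp has `c/a ≠ √(8/3)` (numerically `h*/a* = 0.81638` against `√⅔ = 0.81650`), so that premise is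
(numerically) false for every `a`. This part and XVIII-B (`RelaxedHcp.lean`) repair the sanity check for EVERY layer
spacing in the tube `|h − a√⅔| ≤ a/100`. Here: the integer lemmas `inLayer_le_eighteen`, `adjLayer_le_ten`; the
distance form for a GENERAL spacing `twelve_mul_dist_sq` (`12·dist² = a²(3(2P+Q+Λ)² + (3Q+Λ)²) + 12K²h²`);
`tube_sq_bounds`; **`hcp_window_iff`** (for `0.65a² ≤ h² ≤ 0.69a²` and `12.28a² ≤ 12r² ≤ 18.75a²`, two distinct
sites of `hcpStacking a h` are within `r` iff the ideal sites touch — covers the `5a/4` shell window and the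
`28/25` bond window); and the vertical stretch `tubeMap η h : z ↦ z + (z₂/η)(h − η)e₃` (`tubeMap_barlowPos`:
spacing `η ↦ h` index by index; `dist_tubeMap`; `tubeMap_injective`). All `[folklore]`.
-/

noncomputable section

namespace Summit.AtomisticToContinuum.Crystallization.Theorems.LayeredLawsSelectHcp.Negative.RelaxedHcpWindow

open MeasureTheory Set
open Literature.MathematicalPhysics.StatisticalMechanics Literature.Geometry.DiscreteGeometry
open Summit.AtomisticToContinuum.Crystallization.Theses.PalmUnimodularRigidity (LayeredLawsSelectHcp)
open Summit.AtomisticToContinuum.Crystallization.Theorems.ChargedEnergyGapNegative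
  (eStar eStar_le bddBelow_energyPerParticle_lennardJones)
open Summit.AtomisticToContinuum.Crystallization.Theorems.LayeredLawsSelectHcp.Negative.DiracLaws
open Summit.AtomisticToContinuum.Crystallization.Theorems.LayeredLawsSelectHcp.Negative.IntegerForms
open Summit.AtomisticToContinuum.Crystallization.Theorems.LayeredLawsSelectHcp.Negative.IdealStackings
open Summit.AtomisticToContinuum.Crystallization.Theorems.LayeredLawsSelectHcp.Negative.HexCubic
open Summit.AtomisticToContinuum.Crystallization.Theorems.LayeredLawsSelectHcp.Negative.HcpShells
open Summit.AtomisticToContinuum.Crystallization.Theorems.LayeredLawsSelectHcp.Negative.PeriodicPalmLaw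
open Summit.AtomisticToContinuum.Crystallization.Theorems.LayeredLawsSelectHcp.Negative.PeriodicEnergy
open Summit.AtomisticToContinuum.Crystallization.Theorems.LayeredLawsSelectHcp.Negative.IntendedModel

/-- Euclidean `3`-space. [folklore] -/
local notation "E3" => EuclideanSpace ℝ (Fin 3)

/-! ## Relaxed hcp: the window lemma and the vertical stretch -/

section RelaxedHcp

variable {a h : ℝ}

/-! ### Integer lemmas: the forms below the window thresholds -/

/-- In-layer form `≤ 18` off the origin forces the value `12` (six neighbours). [folklore] -/
theorem inLayer_le_eighteen {P Q : ℤ} (hle : 3 * (2 * P + Q) ^ 2 + (3 * Q) ^ 2 ≤ 18)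
    (hne : (P, Q) ≠ (0, 0)) : 3 * (2 * P + Q) ^ 2 + (3 * Q) ^ 2 = 12 := by
  have hQ : Q ^ 2 ≤ 2 := by nlinarith [sq_nonneg (2 * P + Q)]
  have hQ' : Q ^ 2 ≤ 1 := by
    by_contra hc
    have : 2 ≤ Q ^ 2 := by omega
    have h4 : Q ^ 2 ≠ 2 := fun h2 => by
      have : Q ≤ 1 := by nlinarith
      have : -1 ≤ Q := by nlinarith
      interval_cases Q <;> simp_all
    omega
  have hP4 : (2 * P + Q) ^ 2 ≤ 6 := by nlinarith [sq_nonneg (3 * Q)]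
  have hP : P ^ 2 ≤ 4 := by
    obtain ⟨hQ1, hQ2⟩ := abs_le_one_of_sq_le_one hQ'
    nlinarith
  obtain ⟨hQ1, hQ2⟩ := abs_le_one_of_sq_le_one hQ'
  obtain ⟨hP1, hP2⟩ := abs_le_two_of_sq_le_four hP
  interval_cases P <;> interval_cases Q <;> simp_all

/-- Adjacent-layer form `≤ 10` forces the value `4` (three neighbours), letter shift `σ = ±1`.
[folklore] -/
theorem adjLayer_le_ten {P Q σ : ℤ} (hσ : σ = 1 ∨ σ = -1)
    (hle : 3 * (2 * P + Q + σ) ^ 2 + (3 * Q + σ) ^ 2 ≤ 10) :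
    3 * (2 * P + Q + σ) ^ 2 + (3 * Q + σ) ^ 2 = 4 := by
  have hv : (3 * Q + σ) ^ 2 ≤ 10 := by nlinarith [sq_nonneg (2 * P + Q + σ)]
  have hu3 : 3 * (2 * P + Q + σ) ^ 2 ≤ 10 := by nlinarith [sq_nonneg (3 * Q + σ)]
  have hu : (2 * P + Q + σ) ^ 2 ≤ 3 := by omega
  have hu' : (2 * P + Q + σ) ^ 2 ≤ 1 := by
    by_contra hc
    have h2 : 2 ≤ (2 * P + Q + σ) ^ 2 := by omega
    have : 2 * P + Q + σ ≤ 1 := by nlinarith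
    have : -1 ≤ 2 * P + Q + σ := by nlinarith
    set u := 2 * P + Q + σ
    interval_cases u <;> simp_all
  obtain ⟨hu1, hu2⟩ := abs_le_one_of_sq_le_one hu'
  have hv1 : -3 ≤ 3 * Q + σ := by nlinarith [hv]
  have hv2 : 3 * Q + σ ≤ 3 := by nlinarith [hv]
  rcases hσ with rfl | rfl
  · have hQ1 : -1 ≤ Q := by omega
    have hQ2 : Q ≤ 0 := by omega
    have hP1 : -1 ≤ P := by omega
    have hP2 : P ≤ 1 := by omega
    interval_cases P <;> interval_cases Q <;> simp_all
  · have hQ1 : 0 ≤ Q := by omega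
    have hQ2 : Q ≤ 1 := by omega
    have hP1 : -1 ≤ P := by omega
    have hP2 : P ≤ 1 := by omega
    interval_cases P <;> interval_cases Q <;> simp_all

/-! ### The distance form for a general layer spacing -/

/-- **`12·dist² = a²·(3(2P+Q+Λ)² + (3Q+Λ)²) + 12K²h²`** for ANY layer spacing `h` (`P = i−i'`,
`Q = j−j'`, `K = k−k'`, `Λ = L(k)−L(k')`). [folklore] -/
theorem twelve_mul_dist_sq (a h : ℝ) (s : ℤ → ℤ) (k i j k' i' j' : ℤ) :
    12 * dist (barlowPos a h s k i j) (barlowPos a h s k' i' j') ^ 2 =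
      a ^ 2 * ((3 * (2 * (i - i') + (j - j') + (haggLabel s k - haggLabel s k')) ^ 2 +
        (3 * (j - j') + (haggLabel s k - haggLabel s k')) ^ 2 : ℤ) : ℝ) +
      12 * ((k - k' : ℤ) : ℝ) ^ 2 * h ^ 2 := by
  rw [dist_barlowPos_sq]
  have h3 : (√3 : ℝ) ^ 2 = 3 := Real.sq_sqrt (by norm_num)
  push_cast
  linear_combination (3 * a ^ 2 * ((j - j' : ℝ) + (haggLabel s k - haggLabel s k') / 3) ^ 2) * h3

/-- The letter shift between hcp layers `k` and `k'` with `|k − k'| = 1` is `±1`. [folklore] -/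
theorem haggLabel_alt_sub_of_adj {k k' : ℤ} (hK : k - k' = 1 ∨ k - k' = -1) :
    haggLabel alternatingHagg k - haggLabel alternatingHagg k' = 1 ∨
      haggLabel alternatingHagg k - haggLabel alternatingHagg k' = -1 := by
  by_cases hk : Even k'
  · obtain ⟨h0, h1, h2⟩ := haggLabel_alt_of_even hk
    rcases hK with hK | hK
    · rw [show k = k' + 1 by omega, h1, h0]; simp
    · rw [show k = k' - 1 by omega, h2, h0]; simp
  · obtain ⟨h0, h1, h2⟩ := haggLabel_alt_of_odd hk
    rcases hK with hK | hK
    · rw [show k = k' + 1 by omega, h1, h0]; simp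
    · rw [show k = k' - 1 by omega, h2, h0]; simp

/-- `0.8164 ≤ √(2/3) ≤ 0.8165`. [folklore] -/
theorem sqrt_twoThirds_bounds' : (8164 / 10000 : ℝ) ≤ Real.sqrt (2 / 3) ∧ Real.sqrt (2 / 3) ≤ 8165 / 10000 := by
  constructor
  · rw [show (8164 / 10000 : ℝ) = Real.sqrt ((8164 / 10000) ^ 2) by rw [Real.sqrt_sq (by norm_num)]]
    exact Real.sqrt_le_sqrt (by norm_num)
  · rw [show (8165 / 10000 : ℝ) = Real.sqrt ((8165 / 10000) ^ 2) by rw [Real.sqrt_sq (by norm_num)]]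
    exact Real.sqrt_le_sqrt (by norm_num)

/-- The tube `|h − a√⅔| ≤ a/100` in squared form: `0.65 a² ≤ h² ≤ 0.69 a²` (and `0 < h`).
[folklore] -/
theorem tube_sq_bounds (ha : 0 < a) (ht : |h - a * Real.sqrt (2 / 3)| ≤ a / 100) :
    65 / 100 * a ^ 2 ≤ h ^ 2 ∧ h ^ 2 ≤ 69 / 100 * a ^ 2 ∧ 0 < h := by
  obtain ⟨hs1, hs2⟩ := sqrt_twoThirds_bounds'
  obtain ⟨ht1, ht2⟩ := abs_le.1 ht
  have hlo : 8064 / 10000 * a ≤ h := by nlinarith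
  have hhi : h ≤ 8265 / 10000 * a := by nlinarith
  have hpos : 0 < h := by nlinarith
  refine ⟨by nlinarith, by nlinarith, hpos⟩

/-- **The window lemma for relaxed hcp.** For `0.65a² ≤ h² ≤ 0.69a²` and a window radius `r` with
`12.28 a² ≤ 12r² ≤ 18.75 a²` (e.g. `r = 5a/4`, or `r = 28/25` when `a ∈ [9/10, 1]`): two distinct
sites of `hcpStacking a h` are within distance `r` iff the corresponding sites of the IDEAL hcp of
spacing `a` touch (`dist = a`). Cases on `K = k − k'`: `K = 0` — in-layer form `≤ 18 ⇒ = 12`;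
`|K| = 1` — adjacent form `≤ 10 ⇒ = 4`; `|K| ≥ 2` — both sides false (`48h² > 18.75a²`, `8K² > 12`).
[folklore] -/
theorem hcp_window_iff (ha : 0 < a) (hT1 : 65 / 100 * a ^ 2 ≤ h ^ 2) (hT2 : h ^ 2 ≤ 69 / 100 * a ^ 2)
    {r : ℝ} (hr0 : 0 ≤ r) (hr1 : 1228 / 100 * a ^ 2 ≤ 12 * r ^ 2) (hr2 : 12 * r ^ 2 ≤ 75 / 4 * a ^ 2)
    (k i j k' i' j' : ℤ) :
    ((k, i, j) ≠ (k', i', j') ∧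
        dist (barlowPos a h alternatingHagg k i j) (barlowPos a h alternatingHagg k' i' j') ≤ r) ↔
      dist (barlowPos a (a * Real.sqrt (2 / 3)) alternatingHagg k i j)
        (barlowPos a (a * Real.sqrt (2 / 3)) alternatingHagg k' i' j') = a := by
  rw [dist_barlowPos_eq_iff_form ha (idealRatio_sq a) alternatingHagg k i j k' i' j']
  have h12 := twelve_mul_dist_sq a h alternatingHagg k i j k' i' j'
  set Λ : ℤ := haggLabel alternatingHagg k - haggLabel alternatingHagg k' with hΛ
  set F : ℤ := 3 * (2 * (i - i') + (j - j') + Λ) ^ 2 + (3 * (j - j') + Λ) ^ 2 with hF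
  set D : ℝ := dist (barlowPos a h alternatingHagg k i j) (barlowPos a h alternatingHagg k' i' j') with hD
  have hD0 : 0 ≤ D := dist_nonneg
  have hF0 : (0 : ℤ) ≤ F := by rw [hF]; positivity
  have hF0' : (0 : ℝ) ≤ (F : ℝ) := by exact_mod_cast hF0
  have ha2 : 0 < a ^ 2 := by positivity
  -- `D ≤ r ↔ 12 D² ≤ 12 r²`
  have hDr : D ≤ r ↔ 12 * D ^ 2 ≤ 12 * r ^ 2 := by
    constructor
    · intro hle; nlinarith [mul_self_le_mul_self hD0 hle]
    · intro hle
      exact (pow_le_pow_iff_left₀ hD0 hr0 two_ne_zero).1 (by nlinarith)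
  rcases lt_trichotomy (k - k') 0 with hK | hK | hK
  · rcases eq_or_lt_of_le (Int.le_sub_one_iff.2 hK : k - k' ≤ -1) with hK1 | hK1
    · -- K = -1
      have hσ := haggLabel_alt_sub_of_adj (Or.inr hK1)
      rw [← hΛ] at hσ
      have hKr : ((k - k' : ℤ) : ℝ) = -1 := by exact_mod_cast hK1
      rw [hKr] at h12
      constructor
      · rintro ⟨-, hle⟩
        have h1 : 12 * D ^ 2 ≤ 12 * r ^ 2 := hDr.1 hle
        have hFle : (F : ℝ) * a ^ 2 ≤ 1095 / 100 * a ^ 2 := by nlinarith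
        have hF10 : F ≤ 10 := by
          by_contra hc
          have : (11 : ℝ) ≤ F := by exact_mod_cast (show (11 : ℤ) ≤ F by omega)
          nlinarith
        have hF4 : F = 4 := adjLayer_le_ten hσ hF10
        rw [hF4, hK1]; norm_num
      · intro hF12
        have hF4 : F = 4 := by rw [hK1] at hF12; omega
        refine ⟨fun heq => ?_, hDr.2 ?_⟩
        · simp only [Prod.mk.injEq] at heq; omega
        · have : (F : ℝ) = 4 := by exact_mod_cast hF4
          rw [this] at h12; nlinarith
    · -- K ≤ -2 : both sides false
      have hK2 : (4 : ℝ) ≤ ((k - k' : ℤ) : ℝ) ^ 2 := by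
        have : (k - k' : ℤ) ^ 2 ≥ 4 := by nlinarith
        exact_mod_cast this
      constructor
      · rintro ⟨-, hle⟩
        have h1 := hDr.1 hle
        nlinarith
      · intro hF12
        have : 8 * (k - k') ^ 2 ≤ 12 := by rw [← hF12]; linarith
        nlinarith
  · -- K = 0, Λ = 0
    have hk' : k = k' := by omega
    have hΛ0 : Λ = 0 := by rw [hΛ, hk', sub_self]
    have hKr : ((k - k' : ℤ) : ℝ) = 0 := by exact_mod_cast hK
    rw [hKr] at h12
    have hF' : F = 3 * (2 * (i - i') + (j - j')) ^ 2 + (3 * (j - j')) ^ 2 := by rw [hF, hΛ0]; ring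
    constructor
    · rintro ⟨hne, hle⟩
      have hPQ : (i - i', j - j') ≠ (0, 0) := by
        intro h0; simp only [Prod.mk.injEq, sub_eq_zero] at h0
        exact hne (by rw [hk', h0.1, h0.2])
      have h1 := hDr.1 hle
      have hFle : (F : ℝ) * a ^ 2 ≤ 75 / 4 * a ^ 2 := by nlinarith
      have hF18 : F ≤ 18 := by
        by_contra hc
        have : (19 : ℝ) ≤ F := by exact_mod_cast (show (19 : ℤ) ≤ F by omega)
        nlinarith
      rw [hF'] at hF18 ⊢
      rw [inLayer_le_eighteen hF18 hPQ, hK]; norm_num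
    · intro hF12
      rw [hK] at hF12
      have hF12' : F = 12 := by omega
      refine ⟨fun heq => ?_, hDr.2 ?_⟩
      · simp only [Prod.mk.injEq] at heq
        obtain ⟨-, rfl, rfl⟩ := heq
        rw [hF'] at hF12'; simp at hF12'
      · have : (F : ℝ) = 12 := by exact_mod_cast hF12'
        rw [this] at h12; nlinarith
  · rcases eq_or_lt_of_le (Int.add_one_le_iff.2 hK : 1 ≤ k - k') with hK1 | hK1
    · -- K = 1
      have hσ := haggLabel_alt_sub_of_adj (Or.inl hK1.symm)
      rw [← hΛ] at hσ
      have hKr : ((k - k' : ℤ) : ℝ) = 1 := by exact_mod_cast hK1.symm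
      rw [hKr] at h12
      constructor
      · rintro ⟨-, hle⟩
        have h1 : 12 * D ^ 2 ≤ 12 * r ^ 2 := hDr.1 hle
        have hFle : (F : ℝ) * a ^ 2 ≤ 1095 / 100 * a ^ 2 := by nlinarith
        have hF10 : F ≤ 10 := by
          by_contra hc
          have : (11 : ℝ) ≤ F := by exact_mod_cast (show (11 : ℤ) ≤ F by omega)
          nlinarith
        have hF4 : F = 4 := adjLayer_le_ten hσ hF10
        rw [hF4, ← hK1]; norm_num
      · intro hF12
        have hF4 : F = 4 := by rw [← hK1] at hF12; omega
        refine ⟨fun heq => ?_, hDr.2 ?_⟩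
        · simp only [Prod.mk.injEq] at heq; omega
        · have : (F : ℝ) = 4 := by exact_mod_cast hF4
          rw [this] at h12; nlinarith
    · -- K ≥ 2 : both sides false
      have hK2 : (4 : ℝ) ≤ ((k - k' : ℤ) : ℝ) ^ 2 := by
        have : (k - k' : ℤ) ^ 2 ≥ 4 := by nlinarith
        exact_mod_cast this
      constructor
      · rintro ⟨-, hle⟩
        have h1 := hDr.1 hle
        nlinarith
      · intro hF12
        have : 8 * (k - k') ^ 2 ≤ 12 := by rw [← hF12]; linarith
        nlinarith

/-! ### The vertical stretch `tubeMap η h : z ↦ z + (z₂/η)(h − η)e₃` -/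

/-- The vertical stretch taking layer spacing `η` to `h`. [folklore] -/
def tubeMap (η h : ℝ) (z : E3) : E3 := z + (z 2 / η) • (layerNormal h - layerNormal η)

/-- It maps the stacking of spacing `η` onto the stacking of spacing `h`, index by index. [folklore] -/
theorem tubeMap_barlowPos {η : ℝ} (hη : η ≠ 0) (a h : ℝ) (s : ℤ → ℤ) (k i j : ℤ) :
    tubeMap η h (barlowPos a η s k i j) = barlowPos a h s k i j := by
  ext l
  fin_cases l <;> simp [tubeMap, barlowPos, triangularVec₁, triangularVec₂, barlowOffset, layerNormal]
  field_simp
  ring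

/-- It is additive (indeed linear). [folklore] -/
theorem tubeMap_sub (η h : ℝ) (x y : E3) : tubeMap η h (x - y) = tubeMap η h x - tubeMap η h y := by
  simp only [tubeMap, PiLp.sub_apply, sub_div, sub_smul]
  abel

/-- Its displacement: `dist (tubeMap η h z) z = |z₂/η| · |h − η|`. [folklore] -/
theorem dist_tubeMap (η h : ℝ) (z : E3) : dist (tubeMap η h z) z = |z 2 / η| * |h - η| := by
  rw [dist_eq_norm, tubeMap, add_sub_cancel_left, norm_smul, Real.norm_eq_abs]
  congr 1
  rw [EuclideanSpace.norm_eq, Fin.sum_univ_three]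
  simp [layerNormal, Real.sqrt_sq_eq_abs]

/-- It is injective for `η, h ≠ 0`. [folklore] -/
theorem tubeMap_injective {η h : ℝ} (hη : η ≠ 0) (hh : h ≠ 0) : Function.Injective (tubeMap η h) := by
  intro x y hxy
  have h2 : x 2 = y 2 := by
    have := congrArg (fun z : E3 => z 2) hxy
    simp only [tubeMap, PiLp.add_apply, PiLp.smul_apply, PiLp.sub_apply, layerNormal, smul_eq_mul] at this
    have hx : x 2 + x 2 / η * (h - η) = x 2 * (h / η) := by field_simp; ring
    have hy : y 2 + y 2 / η * (h - η) = y 2 * (h / η) := by field_simp; ring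
    simp at this
    rw [hx, hy] at this
    exact mul_right_cancel₀ (div_ne_zero hh hη) this
  have hxy' : x + (x 2 / η) • (layerNormal h - layerNormal η) =
      y + (y 2 / η) • (layerNormal h - layerNormal η) := hxy
  rw [h2] at hxy'
  exact add_right_cancel hxy'

end RelaxedHcp

end Summit.AtomisticToContinuum.Crystallization.Theorems.LayeredLawsSelectHcp.Negative.RelaxedHcpWindow

end
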